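import Mathlib
import Literature.Analysis.FluidPDE.GaussianVortexPlanar
import Literature.Analysis.FluidPDE.GaussianVortexPlanarProofs
import Summits.AnomalousDissipation.AnomalousDissipation.Theorems.MarginalStabilityChainStretchedVortexRowsStubCoreRotationLocalSkew
import HarnessLib

/-!
# Gaussian-class bookkeeping for the helper `coreInverse_integrability` toward stub `stub_coreInverse` of the line
# `braid-closed-large-circulation-gluing` (crux stmt-AnomalousDissipation-3009, `MarginalStabilityChain.StretchedVortexRows`)

The energy method for the cut-off core operator at the Gaussian vortex `G = gaussVortexProfile = (4π)⁻¹e^{−|ξ|²/4}`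
pairs fields in `X = L²(G⁻¹)`. Every field met there is "measurable × polynomial × Gaussian", and this file is the
bookkeeping that turns such pointwise information into absolutely convergent integrals:

* the **Gaussian class** of a scalar field `X` is a bound `|X(ξ)| ≤ C (1 + |ξ|)ⁿ G(ξ)`; it is stable under sums,
  differences, scalar multiples, multiplication by polynomially bounded scalar fields and inner products of
  polynomially bounded with Gaussian-class vector fields (`gaussClass_add`, `gaussClass_mul_left`,
  `gaussClass_inner_left`, …; the constant is automatically `≥ 0`, `gaussClass_const_nonneg`);
* two a.e. strongly measurable Gaussian-class fields `X, Y` have an integrable pairing `G⁻¹ X Y`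
  (`|G⁻¹XY| ≤ CD(1+|ξ|)^{n+m} G` and `∫ (1+|ξ|)^N G < ∞`, landed
  `integrable_one_add_norm_pow_mul_gaussVortexProfile`): `integrable_invGauss_mul_mul` = the registered helper
  `coreInverse_pairing_integrable`; likewise `G⁻¹(1+|ξ|²)X²`, `G⁻¹X²`, `G⁻¹‖W‖²`, `G⁻¹ΩX²`
  (`Ω = (8π)⁻¹φ(|ξ|²/4) ≤ (8π)⁻¹`) are integrable, and `‖w‖²_Y = ‖w‖²_X + ‖∇w‖²_X` (`gwSobolevNormSq_eq_add`);
* the elementary **Cauchy–Schwarz inequality** `|∫ab| ≤ (∫a²)^{1/2}(∫b²)^{1/2}` (nonnegativity of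
  `t ↦ ∫(ta+b)² = (∫a²)t² + 2(∫ab)t + ∫b²` and `discrim_le_zero`), and its weighted form
  `|∫G⁻¹FH| ≤ (∫G⁻¹(1+|ξ|²)F²)^{1/2}(∫G⁻¹B²)^{1/2}` whenever `H² ≤ (1+|ξ|²)B²` pointwise
  (`abs_integral_invGauss_mul_mul_le`: write `G⁻¹FH = (G^{-1/2}(1+|ξ|²)^{1/2}F)·(G^{-1/2}(1+|ξ|²)^{-1/2}H)`).

References: Th. Gallay, C. E. Wayne, Comm. Math. Phys. 255 (2005) §4 and J. Math. Fluid Mech. 9 (2007), (1.9)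
(the spaces `X = L²(G⁻¹)`, `Y`); Th. Gallay, Y. Maekawa, arXiv:1610.08384, §4.1.
-/

set_option linter.dupNamespace false

noncomputable section

open scoped RealInnerProductSpace Topology
open MeasureTheory WithLp Function Filter Metric Set

namespace Summit.AnomalousDissipation.AnomalousDissipation.Theorems.MarginalStabilityChainStretchedVortexRows

open Literature.Analysis.FluidPDE Literature.Analysis.UnboundedOperators

/-! ### The Gaussian class: bookkeeping of pointwise bounds `|X| ≤ C (1+|ξ|)ⁿ G` -/

/-- The constant of a Gaussian-class bound is nonnegative (read off at `ξ = 0`). [folklore] -/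
theorem gaussClass_const_nonneg {X : EuclideanSpace ℝ (Fin 2) → ℝ} {C : ℝ} {n : ℕ}
    (h : ∀ ξ, |X ξ| ≤ C * (1 + ‖ξ‖) ^ n * gaussVortexProfile ξ) : 0 ≤ C := by
  have h0 := h 0
  rw [norm_zero, add_zero, one_pow, mul_one] at h0
  have hG := gaussVortexProfile_pos (0 : EuclideanSpace ℝ (Fin 2))
  nlinarith [abs_nonneg (X 0)]

/-- Raising the polynomial degree of a Gaussian-class bound. [folklore] -/
theorem gaussClass_mono {X : EuclideanSpace ℝ (Fin 2) → ℝ} {C : ℝ} {n m : ℕ} (hnm : n ≤ m)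
    (h : ∀ ξ, |X ξ| ≤ C * (1 + ‖ξ‖) ^ n * gaussVortexProfile ξ) (ξ : EuclideanSpace ℝ (Fin 2)) :
    |X ξ| ≤ C * (1 + ‖ξ‖) ^ m * gaussVortexProfile ξ :=
  (h ξ).trans (mul_le_mul_of_nonneg_right
    (mul_le_mul_of_nonneg_left (pow_le_pow_right₀ (by linarith [norm_nonneg ξ]) hnm)
      (gaussClass_const_nonneg h)) (gaussVortexProfile_pos ξ).le)

/-- Sums of Gaussian-class fields. [folklore] -/
theorem gaussClass_add {X Y : EuclideanSpace ℝ (Fin 2) → ℝ} {C D : ℝ} {n : ℕ}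
    (hX : ∀ ξ, |X ξ| ≤ C * (1 + ‖ξ‖) ^ n * gaussVortexProfile ξ)
    (hY : ∀ ξ, |Y ξ| ≤ D * (1 + ‖ξ‖) ^ n * gaussVortexProfile ξ) (ξ : EuclideanSpace ℝ (Fin 2)) :
    |X ξ + Y ξ| ≤ (C + D) * (1 + ‖ξ‖) ^ n * gaussVortexProfile ξ :=
  calc |X ξ + Y ξ| ≤ |X ξ| + |Y ξ| := abs_add_le _ _
    _ ≤ C * (1 + ‖ξ‖) ^ n * gaussVortexProfile ξ + D * (1 + ‖ξ‖) ^ n * gaussVortexProfile ξ :=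
        add_le_add (hX ξ) (hY ξ)
    _ = (C + D) * (1 + ‖ξ‖) ^ n * gaussVortexProfile ξ := by ring

/-- Differences of Gaussian-class fields. [folklore] -/
theorem gaussClass_sub {X Y : EuclideanSpace ℝ (Fin 2) → ℝ} {C D : ℝ} {n : ℕ}
    (hX : ∀ ξ, |X ξ| ≤ C * (1 + ‖ξ‖) ^ n * gaussVortexProfile ξ)
    (hY : ∀ ξ, |Y ξ| ≤ D * (1 + ‖ξ‖) ^ n * gaussVortexProfile ξ) (ξ : EuclideanSpace ℝ (Fin 2)) :
    |X ξ - Y ξ| ≤ (C + D) * (1 + ‖ξ‖) ^ n * gaussVortexProfile ξ :=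
  calc |X ξ - Y ξ| ≤ |X ξ| + |Y ξ| := abs_sub _ _
    _ ≤ C * (1 + ‖ξ‖) ^ n * gaussVortexProfile ξ + D * (1 + ‖ξ‖) ^ n * gaussVortexProfile ξ :=
        add_le_add (hX ξ) (hY ξ)
    _ = (C + D) * (1 + ‖ξ‖) ^ n * gaussVortexProfile ξ := by ring

/-- Scalar multiples of Gaussian-class fields. [folklore] -/
theorem gaussClass_const_mul {X : EuclideanSpace ℝ (Fin 2) → ℝ} {C : ℝ} {n : ℕ} (a : ℝ)
    (hX : ∀ ξ, |X ξ| ≤ C * (1 + ‖ξ‖) ^ n * gaussVortexProfile ξ) (ξ : EuclideanSpace ℝ (Fin 2)) :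
    |a * X ξ| ≤ (|a| * C) * (1 + ‖ξ‖) ^ n * gaussVortexProfile ξ := by
  rw [abs_mul, mul_assoc, mul_assoc]
  exact mul_le_mul_of_nonneg_left (by rw [← mul_assoc]; exact hX ξ) (abs_nonneg a)

/-- A polynomially bounded scalar field times a Gaussian-class field. [folklore] -/
theorem gaussClass_mul_left {a X : EuclideanSpace ℝ (Fin 2) → ℝ} {A C : ℝ} {p n : ℕ}
    (ha : ∀ ξ, |a ξ| ≤ A * (1 + ‖ξ‖) ^ p)
    (hX : ∀ ξ, |X ξ| ≤ C * (1 + ‖ξ‖) ^ n * gaussVortexProfile ξ) (ξ : EuclideanSpace ℝ (Fin 2)) :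
    |a ξ * X ξ| ≤ (A * C) * (1 + ‖ξ‖) ^ (p + n) * gaussVortexProfile ξ := by
  rw [abs_mul]
  calc |a ξ| * |X ξ| ≤ (A * (1 + ‖ξ‖) ^ p) * (C * (1 + ‖ξ‖) ^ n * gaussVortexProfile ξ) :=
        mul_le_mul (ha ξ) (hX ξ) (abs_nonneg _) ((abs_nonneg _).trans (ha ξ))
    _ = (A * C) * (1 + ‖ξ‖) ^ (p + n) * gaussVortexProfile ξ := by ring

/-- The inner product of a polynomially bounded vector field with a Gaussian-class vector field. [folklore] -/
theorem gaussClass_inner_left {U W : EuclideanSpace ℝ (Fin 2) → EuclideanSpace ℝ (Fin 2)} {A C : ℝ} {p n : ℕ}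
    (hU : ∀ ξ, ‖U ξ‖ ≤ A * (1 + ‖ξ‖) ^ p)
    (hW : ∀ ξ, ‖W ξ‖ ≤ C * (1 + ‖ξ‖) ^ n * gaussVortexProfile ξ) (ξ : EuclideanSpace ℝ (Fin 2)) :
    |⟪U ξ, W ξ⟫| ≤ (A * C) * (1 + ‖ξ‖) ^ (p + n) * gaussVortexProfile ξ :=
  calc |⟪U ξ, W ξ⟫| ≤ ‖U ξ‖ * ‖W ξ‖ := abs_real_inner_le_norm _ _
    _ ≤ (A * (1 + ‖ξ‖) ^ p) * (C * (1 + ‖ξ‖) ^ n * gaussVortexProfile ξ) :=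
        mul_le_mul (hU ξ) (hW ξ) (norm_nonneg _) ((norm_nonneg _).trans (hU ξ))
    _ = (A * C) * (1 + ‖ξ‖) ^ (p + n) * gaussVortexProfile ξ := by ring

/-! ### Integrability against `G⁻¹` and the Cauchy–Schwarz inequality -/

/-- **The pairing of two Gaussian-class fields in `L²(G⁻¹)` converges absolutely**: if `X, Y` are a.e. strongly
measurable with `|X| ≤ C(1+|ξ|)ⁿG`, `|Y| ≤ D(1+|ξ|)ᵐG`, then `G⁻¹ X Y` is integrable
(`|G⁻¹XY| ≤ CD(1+|ξ|)^{n+m}G` and the Gaussian has all polynomial moments). [folklore] -/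
theorem integrable_invGauss_mul_mul {X Y : EuclideanSpace ℝ (Fin 2) → ℝ} {C D : ℝ} {n m : ℕ}
    (hXm : AEStronglyMeasurable X volume) (hYm : AEStronglyMeasurable Y volume)
    (hX : ∀ ξ, |X ξ| ≤ C * (1 + ‖ξ‖) ^ n * gaussVortexProfile ξ)
    (hY : ∀ ξ, |Y ξ| ≤ D * (1 + ‖ξ‖) ^ m * gaussVortexProfile ξ) :
    Integrable fun ξ => (gaussVortexProfile ξ)⁻¹ * X ξ * Y ξ := by
  have hGc : Continuous gaussVortexProfile := (contDiff_gaussVortexProfile (n := 0)).continuous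
  refine ((integrable_one_add_norm_pow_mul_gaussVortexProfile (n + m)).const_mul (C * D)).mono'
    (((hGc.inv₀ fun ξ => (gaussVortexProfile_pos ξ).ne').aestronglyMeasurable.mul hXm).mul hYm)
    (Eventually.of_forall fun ξ => ?_)
  have hG := gaussVortexProfile_pos ξ
  rw [Real.norm_eq_abs, abs_mul, abs_mul, abs_inv, abs_of_pos hG]
  have h0 : 0 ≤ C * (1 + ‖ξ‖) ^ n * gaussVortexProfile ξ := (abs_nonneg _).trans (hX ξ)
  calc (gaussVortexProfile ξ)⁻¹ * |X ξ| * |Y ξ|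
      ≤ (gaussVortexProfile ξ)⁻¹ *
          ((C * (1 + ‖ξ‖) ^ n * gaussVortexProfile ξ) * (D * (1 + ‖ξ‖) ^ m * gaussVortexProfile ξ)) := by
        rw [mul_assoc]
        exact mul_le_mul_of_nonneg_left (mul_le_mul (hX ξ) (hY ξ) (abs_nonneg _) h0) (inv_nonneg.2 hG.le)
    _ = C * D * ((1 + ‖ξ‖) ^ (n + m) * gaussVortexProfile ξ) := by
        field_simp
        ring

/-- **The weighted square `G⁻¹(1+|ξ|²)X²` of a measurable Gaussian-class field is integrable.** [folklore] -/
theorem integrable_invGauss_mul_one_add_norm_sq_mul_sq {X : EuclideanSpace ℝ (Fin 2) → ℝ} {C : ℝ} {n : ℕ}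
    (hXm : AEStronglyMeasurable X volume) (hX : ∀ ξ, |X ξ| ≤ C * (1 + ‖ξ‖) ^ n * gaussVortexProfile ξ) :
    Integrable fun ξ => (gaussVortexProfile ξ)⁻¹ * (1 + ‖ξ‖ ^ 2) * X ξ ^ 2 := by
  have h1 : ∀ ξ : EuclideanSpace ℝ (Fin 2), |(1 + ‖ξ‖ ^ 2) * X ξ| ≤
      C * (1 + ‖ξ‖) ^ (2 + n) * gaussVortexProfile ξ := by
    intro ξ
    rw [abs_mul, abs_of_pos (by positivity)]
    have hsq : 1 + ‖ξ‖ ^ 2 ≤ 1 * (1 + ‖ξ‖) ^ 2 := by nlinarith [norm_nonneg ξ]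
    calc (1 + ‖ξ‖ ^ 2) * |X ξ| ≤ 1 * (1 + ‖ξ‖) ^ 2 * (C * (1 + ‖ξ‖) ^ n * gaussVortexProfile ξ) :=
          mul_le_mul hsq (hX ξ) (abs_nonneg _) (by positivity)
      _ = C * (1 + ‖ξ‖) ^ (2 + n) * gaussVortexProfile ξ := by ring
  have hm : AEStronglyMeasurable (fun ξ : EuclideanSpace ℝ (Fin 2) => (1 + ‖ξ‖ ^ 2) * X ξ) volume :=
    ((continuous_const.add (continuous_norm.pow 2)).aestronglyMeasurable).mul hXm
  have h := integrable_invGauss_mul_mul hm hXm h1 hX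
  refine h.congr (Eventually.of_forall fun ξ => ?_)
  simp only
  ring

/-- **Cauchy–Schwarz for real integrals** `|∫ab| ≤ (∫a²)^{1/2}(∫b²)^{1/2}` (for integrable `a², b², ab`), from the
nonnegativity of `t ↦ ∫(ta+b)² = (∫a²)t² + 2(∫ab)t + ∫b²` and its discriminant. [folklore] -/
theorem abs_integral_mul_le_sqrt_mul_sqrt {a b : EuclideanSpace ℝ (Fin 2) → ℝ}
    (ha : Integrable fun x => a x ^ 2) (hb : Integrable fun x => b x ^ 2) (hab : Integrable fun x => a x * b x) :
    |∫ x, a x * b x| ≤ Real.sqrt (∫ x, a x ^ 2) * Real.sqrt (∫ x, b x ^ 2) := by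
  have hA : 0 ≤ ∫ x, a x ^ 2 := integral_nonneg fun x => sq_nonneg _
  have hquad : ∀ t : ℝ, 0 ≤ (∫ x, a x ^ 2) * (t * t) + 2 * (∫ x, a x * b x) * t + ∫ x, b x ^ 2 := by
    intro t
    have hfun : (fun x => (t * a x + b x) ^ 2) = fun x => t ^ 2 * a x ^ 2 + 2 * t * (a x * b x) + b x ^ 2 := by
      funext x; ring
    have i1 : Integrable fun x => t ^ 2 * a x ^ 2 := ha.const_mul _
    have i2 : Integrable fun x => 2 * t * (a x * b x) := hab.const_mul _
    have i12 : Integrable fun x => t ^ 2 * a x ^ 2 + 2 * t * (a x * b x) := i1.add i2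
    have heq : ∫ x, (t * a x + b x) ^ 2 = (∫ x, a x ^ 2) * (t * t) + 2 * (∫ x, a x * b x) * t + ∫ x, b x ^ 2 := by
      rw [hfun, integral_add i12 hb, integral_add i1 i2, integral_const_mul, integral_const_mul]
      ring
    rw [← heq]
    exact integral_nonneg fun x => sq_nonneg _
  have hdisc := discrim_le_zero hquad
  rw [discrim] at hdisc
  have hP2 : (∫ x, a x * b x) ^ 2 ≤ (∫ x, a x ^ 2) * ∫ x, b x ^ 2 := by nlinarith
  rw [← Real.sqrt_mul hA]
  exact Real.abs_le_sqrt hP2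

/-- **Weighted Cauchy–Schwarz in `L²(G⁻¹)`**: if `H² ≤ (1+|ξ|²)B²` pointwise, then
`|∫ G⁻¹ F H| ≤ (∫ G⁻¹(1+|ξ|²)F²)^{1/2} (∫ G⁻¹B²)^{1/2}` — write `G⁻¹FH = (G^{-1/2}(1+|ξ|²)^{1/2}F)(G^{-1/2}(1+|ξ|²)^{-1/2}H)`. [folklore] -/
theorem abs_integral_invGauss_mul_mul_le {F H B : EuclideanSpace ℝ (Fin 2) → ℝ}
    (hF2 : Integrable fun ξ => (gaussVortexProfile ξ)⁻¹ * (1 + ‖ξ‖ ^ 2) * F ξ ^ 2)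
    (hFH : Integrable fun ξ => (gaussVortexProfile ξ)⁻¹ * F ξ * H ξ)
    (hHm : AEStronglyMeasurable H volume)
    (hB2 : Integrable fun ξ => (gaussVortexProfile ξ)⁻¹ * B ξ ^ 2)
    (hHB : ∀ ξ, H ξ ^ 2 ≤ (1 + ‖ξ‖ ^ 2) * B ξ ^ 2) :
    |∫ ξ, (gaussVortexProfile ξ)⁻¹ * F ξ * H ξ| ≤
      Real.sqrt (∫ ξ, (gaussVortexProfile ξ)⁻¹ * (1 + ‖ξ‖ ^ 2) * F ξ ^ 2) *
        Real.sqrt (∫ ξ, (gaussVortexProfile ξ)⁻¹ * B ξ ^ 2) := by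
  -- the two factors
  set a : EuclideanSpace ℝ (Fin 2) → ℝ := fun ξ =>
    Real.sqrt ((gaussVortexProfile ξ)⁻¹) * Real.sqrt (1 + ‖ξ‖ ^ 2) * F ξ with ha_def
  set b : EuclideanSpace ℝ (Fin 2) → ℝ := fun ξ =>
    Real.sqrt ((gaussVortexProfile ξ)⁻¹) * (Real.sqrt (1 + ‖ξ‖ ^ 2))⁻¹ * H ξ with hb_def
  have hGi : ∀ ξ : EuclideanSpace ℝ (Fin 2), 0 < (gaussVortexProfile ξ)⁻¹ := fun ξ =>
    inv_pos.2 (gaussVortexProfile_pos ξ)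
  have hr : ∀ ξ : EuclideanSpace ℝ (Fin 2), 0 < 1 + ‖ξ‖ ^ 2 := fun ξ => by positivity
  have hab_eq : ∀ ξ, a ξ * b ξ = (gaussVortexProfile ξ)⁻¹ * F ξ * H ξ := by
    intro ξ
    have h1 : Real.sqrt ((gaussVortexProfile ξ)⁻¹) * Real.sqrt ((gaussVortexProfile ξ)⁻¹) =
        (gaussVortexProfile ξ)⁻¹ := Real.mul_self_sqrt (hGi ξ).le
    have h2 : Real.sqrt (1 + ‖ξ‖ ^ 2) * (Real.sqrt (1 + ‖ξ‖ ^ 2))⁻¹ = 1 :=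
      mul_inv_cancel₀ (Real.sqrt_pos.2 (hr ξ)).ne'
    calc a ξ * b ξ = (Real.sqrt ((gaussVortexProfile ξ)⁻¹) * Real.sqrt ((gaussVortexProfile ξ)⁻¹)) *
          (Real.sqrt (1 + ‖ξ‖ ^ 2) * (Real.sqrt (1 + ‖ξ‖ ^ 2))⁻¹) * (F ξ * H ξ) := by
            simp only [ha_def, hb_def]; ring
      _ = (gaussVortexProfile ξ)⁻¹ * F ξ * H ξ := by rw [h1, h2]; ring
  have ha2_eq : ∀ ξ, a ξ ^ 2 = (gaussVortexProfile ξ)⁻¹ * (1 + ‖ξ‖ ^ 2) * F ξ ^ 2 := by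
    intro ξ
    simp only [ha_def]
    rw [mul_pow, mul_pow, Real.sq_sqrt (hGi ξ).le, Real.sq_sqrt (hr ξ).le]
  have hb2_eq : ∀ ξ, b ξ ^ 2 = (gaussVortexProfile ξ)⁻¹ * (1 + ‖ξ‖ ^ 2)⁻¹ * H ξ ^ 2 := by
    intro ξ
    simp only [hb_def]
    rw [mul_pow, mul_pow, inv_pow, Real.sq_sqrt (hGi ξ).le, Real.sq_sqrt (hr ξ).le]
  have hb2_le : ∀ ξ, b ξ ^ 2 ≤ (gaussVortexProfile ξ)⁻¹ * B ξ ^ 2 := by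
    intro ξ
    rw [hb2_eq]
    calc (gaussVortexProfile ξ)⁻¹ * (1 + ‖ξ‖ ^ 2)⁻¹ * H ξ ^ 2
        ≤ (gaussVortexProfile ξ)⁻¹ * (1 + ‖ξ‖ ^ 2)⁻¹ * ((1 + ‖ξ‖ ^ 2) * B ξ ^ 2) :=
          mul_le_mul_of_nonneg_left (hHB ξ) (mul_nonneg (hGi ξ).le (inv_nonneg.2 (hr ξ).le))
      _ = (gaussVortexProfile ξ)⁻¹ * B ξ ^ 2 := by field_simp
  -- integrability of `a², b², ab`
  have ha2 : Integrable fun ξ => a ξ ^ 2 := hF2.congr (Eventually.of_forall fun ξ => (ha2_eq ξ).symm)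
  have hab : Integrable fun ξ => a ξ * b ξ := hFH.congr (Eventually.of_forall fun ξ => (hab_eq ξ).symm)
  have hGc : Continuous gaussVortexProfile := (contDiff_gaussVortexProfile (n := 0)).continuous
  have hbm : AEStronglyMeasurable b volume := by
    refine (Continuous.aestronglyMeasurable ?_).mul hHm
    exact ((hGc.inv₀ fun ξ => (gaussVortexProfile_pos ξ).ne').sqrt).mul
      ((continuous_const.add (continuous_norm.pow 2)).sqrt.inv₀ fun ξ => (Real.sqrt_pos.2 (hr ξ)).ne')
  have hb2 : Integrable fun ξ => b ξ ^ 2 :=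
    hB2.mono' (hbm.pow 2) (Eventually.of_forall fun ξ => by
      rw [Real.norm_of_nonneg (sq_nonneg _)]; exact hb2_le ξ)
  -- Cauchy–Schwarz
  have hCS := abs_integral_mul_le_sqrt_mul_sqrt ha2 hb2 hab
  have e1 : ∫ ξ, a ξ * b ξ = ∫ ξ, (gaussVortexProfile ξ)⁻¹ * F ξ * H ξ :=
    integral_congr_ae (Eventually.of_forall hab_eq)
  have e2 : ∫ ξ, a ξ ^ 2 = ∫ ξ, (gaussVortexProfile ξ)⁻¹ * (1 + ‖ξ‖ ^ 2) * F ξ ^ 2 :=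
    integral_congr_ae (Eventually.of_forall ha2_eq)
  rw [e1, e2] at hCS
  exact hCS.trans (mul_le_mul_of_nonneg_left (Real.sqrt_le_sqrt (integral_mono hb2 hB2 hb2_le))
    (Real.sqrt_nonneg _))

/-- `G⁻¹ X²` is integrable for a measurable Gaussian-class scalar field `X`. [folklore] -/
theorem integrable_invGauss_mul_sq {X : EuclideanSpace ℝ (Fin 2) → ℝ} {C : ℝ} {n : ℕ}
    (hXm : AEStronglyMeasurable X volume) (hX : ∀ ξ, |X ξ| ≤ C * (1 + ‖ξ‖) ^ n * gaussVortexProfile ξ) :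
    Integrable fun ξ => (gaussVortexProfile ξ)⁻¹ * X ξ ^ 2 :=
  (integrable_invGauss_mul_mul hXm hXm hX hX).congr (Eventually.of_forall fun ξ => by simp only; ring)

/-- `G⁻¹ ‖W‖²` is integrable for a measurable Gaussian-class vector field `W`. [folklore] -/
theorem integrable_invGauss_mul_norm_sq {W : EuclideanSpace ℝ (Fin 2) → EuclideanSpace ℝ (Fin 2)} {C : ℝ} {n : ℕ}
    (hWm : AEStronglyMeasurable W volume) (hW : ∀ ξ, ‖W ξ‖ ≤ C * (1 + ‖ξ‖) ^ n * gaussVortexProfile ξ) :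
    Integrable fun ξ => (gaussVortexProfile ξ)⁻¹ * ‖W ξ‖ ^ 2 :=
  integrable_invGauss_mul_sq hWm.norm fun ξ => by rw [abs_norm]; exact hW ξ

/-- `G⁻¹ Ω X²` is integrable for a measurable Gaussian-class scalar field `X`, `Ω = (8π)⁻¹φ(|ξ|²/4) ∈ (0, (8π)⁻¹]`
the angular velocity of the Gaussian vortex. [folklore] -/
theorem integrable_invGauss_mul_omega_mul_sq {X : EuclideanSpace ℝ (Fin 2) → ℝ} {C : ℝ} {n : ℕ}
    (hXm : AEStronglyMeasurable X volume) (hX : ∀ ξ, |X ξ| ≤ C * (1 + ‖ξ‖) ^ n * gaussVortexProfile ξ) :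
    Integrable fun ξ => (gaussVortexProfile ξ)⁻¹ * ((8 * Real.pi)⁻¹ * burgersPhi (‖ξ‖ ^ 2 / 4)) * X ξ ^ 2 := by
  have hΩ : ∀ ξ : EuclideanSpace ℝ (Fin 2), |(8 * Real.pi)⁻¹ * burgersPhi (‖ξ‖ ^ 2 / 4)| ≤ 1 * (1 + ‖ξ‖) ^ 0 := by
    intro ξ
    have hφ : burgersPhi (‖ξ‖ ^ 2 / 4) ≤ 1 := burgersPhi_le_one (by positivity)
    have hφ0 : 0 < burgersPhi (‖ξ‖ ^ 2 / 4) := burgersPhi_pos _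
    have hc : (8 * Real.pi)⁻¹ ≤ 1 := inv_le_one_of_one_le₀ (by nlinarith [Real.pi_gt_three])
    have hc0 : 0 < (8 * Real.pi)⁻¹ := by positivity
    rw [abs_of_pos (mul_pos hc0 hφ0), pow_zero, mul_one]
    nlinarith
  have hΩc : Continuous fun ξ : EuclideanSpace ℝ (Fin 2) => (8 * Real.pi)⁻¹ * burgersPhi (‖ξ‖ ^ 2 / 4) :=
    continuous_const.mul ((contDiff_burgersPhi (n := 0)).continuous.comp ((continuous_norm.pow 2).div_const _))
  have hm : AEStronglyMeasurable (fun ξ : EuclideanSpace ℝ (Fin 2) =>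
      (8 * Real.pi)⁻¹ * burgersPhi (‖ξ‖ ^ 2 / 4) * X ξ) volume := hΩc.aestronglyMeasurable.mul hXm
  exact (integrable_invGauss_mul_mul hm hXm (gaussClass_mul_left hΩ hX) hX).congr
    (Eventually.of_forall fun ξ => by simp only; ring)

/-- The splitting `‖w‖²_Y = ‖w‖²_X + ‖∇w‖²_X` of Gallay–Wayne's `Y`-norm, when both pieces are integrable. [folklore] -/
theorem gwSobolevNormSq_eq_add {w : EuclideanSpace ℝ (Fin 2) → ℝ}
    (h1 : Integrable fun ξ => (gaussVortexProfile ξ)⁻¹ * w ξ ^ 2)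
    (h2 : Integrable fun ξ => (gaussVortexProfile ξ)⁻¹ * ‖gradient w ξ‖ ^ 2) :
    gwSobolevNormSq w = (∫ ξ, (gaussVortexProfile ξ)⁻¹ * w ξ ^ 2) +
      ∫ ξ, (gaussVortexProfile ξ)⁻¹ * ‖gradient w ξ‖ ^ 2 := by
  rw [gwSobolevNormSq, ← integral_add h1 h2]
  exact integral_congr_ae (Eventually.of_forall fun ξ => mul_add _ _ _)

/-! ### The registered helper: absolute convergence of the `L²(G⁻¹)` pairings -/

/-- **Registered helper `coreInverse_pairing_integrable`** toward `stub_coreInverse`: the `L²(G⁻¹)`-pairing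
`∫ G⁻¹ X Y` of two a.e. strongly measurable Gaussian-class fields converges absolutely. [folklore] -/
theorem coreInverse_pairing_integrable :
    ∀ (X Y : EuclideanSpace ℝ (Fin 2) → ℝ) (C D : ℝ) (n m : ℕ),
      AEStronglyMeasurable X volume → AEStronglyMeasurable Y volume →
      (∀ ξ, |X ξ| ≤ C * (1 + ‖ξ‖) ^ n * gaussVortexProfile ξ) →
      (∀ ξ, |Y ξ| ≤ D * (1 + ‖ξ‖) ^ m * gaussVortexProfile ξ) →
      Integrable fun ξ => (gaussVortexProfile ξ)⁻¹ * X ξ * Y ξ :=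
  fun _ _ _ _ _ _ hXm hYm hX hY => integrable_invGauss_mul_mul hXm hYm hX hY

end Summit.AnomalousDissipation.AnomalousDissipation.Theorems.MarginalStabilityChainStretchedVortexRows

end
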